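import Mathlib
import HarnessLib

/-!
# The canonical twisted radicand at a vertex of weight `d` with `p ∤ d` (R-T, existence half)
(crux stmt-ResolutionOfSingularities-15640 `WildQuotients.WildQuotientResolution`, line `Sketch`;
chain w45c, NEXT RUNG «R-T general twisted root charts» (`L/w45c/CHAIN.md` v7.9 §5/(III)), first
kernel brick, res-L1-w45c-plan-1 NAMING 09:44:26Z to res-D-pv-033 AS res-L1-w45c-stub-5; source =
res-L1-w45c-tri-2's memo `L/res-L1-w45c-tri-2/CHAR2-TWIST.md` v2.1.1 (sha16 0d6da3da09d44e34) §1.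
[OURS · L1 W4.5c] — pure algebra, NOT a statement of any manuscript; replaces the role of no printed
item; AI-written, kernel-checked, weaker than expert review.)

SETTING (tri-2 §1). `K` a commutative ring with an endomorphism `σ` of finite order `p`
(`σ^[p] = id`; the function ring of the `σ`-stable piece), `x ∈ K` (the coordinate whose `d`-th root
the plain `μ_d`-root chart adjoins), `N := ∏_{i<p} σ^i x` (the norm element). If `gcd(p, d) = 1`
choose `a, b ∈ ℕ` with `p·a = d·b + 1`; in the Kummer ring `L := K[T]/(T^d − N)` the class `ρ` of `T`
is fixed by the extension `τ` of `σ` (`T ↦ T`, well defined because `σ N = N`), and for `x` a unit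
`s := ρ^a / x^b` satisfies **`s^d = x · C^a`** with `C := N / x^p` (a unit wherever the `σ^i x / x`
are) and **`τ(s) · σ(x)^b = s · x^b`**, i.e. `τ s = s · (x/σx)^b ∈ s·K`: a `σ`-STABLE `d`-th root of
`x · (unit)` — «at every vertex of weight `d` with `p ∤ d` the twisted radicand exists», uniformly in
the Jordan size (σ is abstract). For `gcd(p, d) ≠ 1` no `a, b` exist (the `μ_p`-vertex, tri-2 §6).

CONTENTS (no `def`s): `prod_iterate_invariant` (R1: `σ N = N`), `exists_bezout_of_coprime`
(R2), `twistedRadicand_pow` / `map_twistedRadicand_mul` / `map_twistedRadicand` /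
`isUnit_normQuot` (R3: the identities in ANY commutative ring `L` with an endomorphism `τ`),
`exists_kummer_extension` (R4: `L`, `τ ⊇ σ`, `ρ` with `ρ^d = N`, `τ ρ = ρ`, `K → L` injective for
`d ≥ 1`), `exists_twistedRadicand` (R1–R4 assembled: the radicand `s` with both laws, for any
`σ`-ring `K`, unit `x`, `gcd(p,d) = 1`), `exists_twistedRadicand_mvPolynomial` (R5: the `J_m` data —
any finite-order `k`-automorphism of `k[x₁,…,xₙ]`, any variable `x_j`, over `k(x₁,…,xₙ)`).
-/

-- single-problem summit: the doubled namespace component `ResolutionOfSingularities` is forced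
set_option linter.dupNamespace false

noncomputable section

open Polynomial

namespace Summit.ResolutionOfSingularities.ResolutionOfSingularities.Theorems.WildQuotientResolution.TwistedRoot

/-! ## (R1) the norm element is invariant -/

/-- **(R1)** For an endomorphism `σ` of a commutative monoid with `σ^[p] = id`, the norm element
`N_σ(x) = ∏_{i<p} σ^i x` is `σ`-invariant. [folklore; tri-2 CHAR2-TWIST §1] -/
theorem prod_iterate_invariant {A F : Type*} [CommMonoid A] [FunLike F A A] [MonoidHomClass F A A]
    (σ : F) {p : ℕ} (hσ : ∀ y, (⇑σ)^[p] y = y) (x : A) :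
    σ (∏ i ∈ Finset.range p, (⇑σ)^[i] x) = ∏ i ∈ Finset.range p, (⇑σ)^[i] x := by
  rw [map_prod]
  cases p with
  | zero => simp
  | succ m =>
    rw [Finset.prod_range_succ (fun i => σ ((⇑σ)^[i] x)),
      Finset.prod_range_succ' (fun i => (⇑σ)^[i] x)]
    have h1 : ∀ i, σ ((⇑σ)^[i] x) = (⇑σ)^[i + 1] x := fun i =>
      (Function.iterate_succ_apply' (⇑σ) i x).symm
    simp only [h1, Function.iterate_zero, id_eq, hσ]

/-! ## (R2) Bézout in the form `p·a = d·b + 1` -/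

/-- **(R2)** If `gcd(p, d) = 1` (`p, d ≥ 1`) there are natural numbers `a ≥ 1`, `b` with
`p·a = d·b + 1`. [folklore] -/
theorem exists_bezout_of_coprime {p d : ℕ} (hp : 0 < p) (hd : 0 < d) (h : Nat.Coprime p d) :
    ∃ a b : ℕ, 0 < a ∧ p * a = d * b + 1 := by
  rcases Nat.lt_or_ge 1 d with hd1 | hd1
  · obtain ⟨m, -, hm⟩ := Nat.exists_mul_mod_eq_one_of_coprime h hd1
    refine ⟨m, p * m / d, ?_, ?_⟩
    · rcases Nat.eq_zero_or_pos m with rfl | hm0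
      · simp at hm
      · exact hm0
    · have := Nat.div_add_mod (p * m) d
      rw [hm] at this
      exact this.symm
  · have hd' : d = 1 := le_antisymm hd1 hd
    subst hd'
    refine ⟨1, p - 1, one_pos, ?_⟩
    omega

/-! ## (R3) the radicand identities in any commutative ring with an endomorphism -/

/-- **(R3a) `s^d = x · C^a`.** In a commutative ring `L`: if `x` is a unit with inverse `y`
(`x * y = 1`), `ρ^d = N` and `p·a = d·b + 1`, then `s := ρ^a · y^b` satisfies
`s^d = x · (N · y^p)^a` (`C := N·y^p = N/x^p`). [folklore; tri-2 CHAR2-TWIST §1] -/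
theorem twistedRadicand_pow {L : Type*} [CommRing L] {p d a b : ℕ} (hab : p * a = d * b + 1)
    (x y ρ N : L) (hxy : x * y = 1) (hρ : ρ ^ d = N) :
    (ρ ^ a * y ^ b) ^ d = x * (N * y ^ p) ^ a := by
  rw [mul_pow, ← pow_mul, mul_comm a d, pow_mul, hρ, ← pow_mul, mul_pow, ← pow_mul, hab,
    pow_succ, mul_comm b d]
  linear_combination (-(N ^ a * y ^ (d * b))) * hxy

/-- **(R3b) `τ(s) · τ(x)^b = s · x^b`** (division-free form of `τ s = s · (x/τx)^b`): with `τ ρ = ρ`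
and `x * y = 1`. [folklore; tri-2 CHAR2-TWIST §1] -/
theorem map_twistedRadicand_mul {L : Type*} [CommRing L] (τ : L →+* L) (a b : ℕ) (x y ρ : L)
    (hxy : x * y = 1) (hτρ : τ ρ = ρ) :
    τ (ρ ^ a * y ^ b) * τ x ^ b = (ρ ^ a * y ^ b) * x ^ b := by
  have h1 : τ y * τ x = 1 := by rw [← map_mul, mul_comm, hxy, map_one]
  rw [map_mul, map_pow, map_pow, hτρ, mul_assoc, ← mul_pow, h1, mul_assoc, ← mul_pow,
    mul_comm y x, hxy]

/-- **(R3b′) `τ s = s · (x · (τx)⁻¹)^b`** for a unit `x` (unit form). [folklore] -/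
theorem map_twistedRadicand {L : Type*} [CommRing L] (τ : L →+* L) (a b : ℕ) (x : Lˣ) (ρ : L)
    (hτρ : τ ρ = ρ) :
    τ (ρ ^ a * (↑x⁻¹ : L) ^ b) =
      (ρ ^ a * (↑x⁻¹ : L) ^ b) * ((x : L) * ↑(Units.map (τ : L →* L) x)⁻¹) ^ b := by
  have h := map_twistedRadicand_mul τ a b (x : L) (↑x⁻¹ : L) ρ (Units.mul_inv x) hτρ
  have h2 : (τ (x : L)) * ↑(Units.map (τ : L →* L) x)⁻¹ = 1 := by
    rw [Units.coe_map_inv]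
    change τ (x : L) * τ (↑x⁻¹ : L) = 1
    rw [← map_mul, Units.mul_inv, map_one]
  calc τ (ρ ^ a * (↑x⁻¹ : L) ^ b)
      = τ (ρ ^ a * (↑x⁻¹ : L) ^ b) * (τ (x : L) * ↑(Units.map (τ : L →* L) x)⁻¹) ^ b := by
        rw [h2, one_pow, mul_one]
    _ = (τ (ρ ^ a * (↑x⁻¹ : L) ^ b) * τ (x : L) ^ b) * (↑(Units.map (τ : L →* L) x)⁻¹ : L) ^ b := by
        rw [mul_pow, mul_assoc]
    _ = (ρ ^ a * (↑x⁻¹ : L) ^ b) * ((x : L) * ↑(Units.map (τ : L →* L) x)⁻¹) ^ b := by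
        rw [h, mul_pow, mul_assoc]

/-- **(R3c) `C = N/x^p` is a unit** when `x` is: every `τ^i x` is a unit, hence so is
`(∏_{i<p} τ^i x) · y^p`. [folklore] -/
theorem isUnit_normQuot {L : Type*} [CommRing L] (τ : L →+* L) (p : ℕ) (x y : L) (hxy : x * y = 1) :
    IsUnit ((∏ i ∈ Finset.range p, (⇑τ)^[i] x) * y ^ p) := by
  have hx : IsUnit x := isUnit_iff_exists_inv.mpr ⟨y, hxy⟩
  have hy : IsUnit y := isUnit_iff_exists_inv.mpr ⟨x, by rw [mul_comm, hxy]⟩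
  refine IsUnit.mul ?_ (hy.pow p)
  refine Finset.prod_induction _ IsUnit (fun a b ha hb => ha.mul hb) isUnit_one ?_
  intro i _
  rw [← RingHom.coe_pow]
  exact hx.map _

/-! ## (R4) the Kummer ring `K[T]/(T^d − N)` with `σ` extended -/

/-- **(R4)** For an endomorphism `σ` of a commutative ring `K` with `σ^[p] = id`, every `x` and
every `d ≥ 1`, there is a commutative `K`-algebra `L` with `K → L` injective, an endomorphism `τ` of
`L` extending `σ`, and a `τ`-FIXED `ρ ∈ L` with `ρ^d = N_σ(x)` — namely `L := K[T]/(T^d − N)`,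
`τ := (σ on coefficients, T ↦ T)`, well defined by (R1). [folklore; tri-2 CHAR2-TWIST §1] -/
theorem exists_kummer_extension {K : Type} [CommRing K] (σ : K →+* K) {p : ℕ}
    (hσ : ∀ y, (⇑σ)^[p] y = y) {d : ℕ} (hd : 0 < d) (x : K) :
    ∃ (L : Type) (_ : CommRing L) (_ : Algebra K L) (τ : L →+* L) (ρ : L),
      Function.Injective (algebraMap K L) ∧
      (∀ y, τ (algebraMap K L y) = algebraMap K L (σ y)) ∧ τ ρ = ρ ∧
      ρ ^ d = algebraMap K L (∏ i ∈ Finset.range p, (⇑σ)^[i] x) := by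
  classical
  set N : K := ∏ i ∈ Finset.range p, (⇑σ)^[i] x with hN
  have hσN : σ N = N := prod_iterate_invariant σ hσ x
  let f : K[X] := X ^ d - C N
  have hf : f.Monic := monic_X_pow_sub_C N hd.ne'
  have hroot : (AdjoinRoot.root f) ^ d = AdjoinRoot.of f N := by
    have h0 := AdjoinRoot.eval₂_root f
    rw [eval₂_sub, eval₂_X_pow, eval₂_C, sub_eq_zero] at h0
    exact h0
  -- `τ`: `σ` on coefficients, `T ↦ T`
  have hev : f.eval₂ ((AdjoinRoot.of f).comp σ) (AdjoinRoot.root f) = 0 := by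
    rw [eval₂_sub, eval₂_X_pow, eval₂_C, RingHom.comp_apply, hσN, hroot, sub_self]
  refine ⟨AdjoinRoot f, inferInstance, inferInstance,
    AdjoinRoot.lift ((AdjoinRoot.of f).comp σ) (AdjoinRoot.root f) hev, AdjoinRoot.root f,
    ?_, fun y => ?_, ?_, ?_⟩
  · -- `K → K[T]/(f)` is injective for monic `f` of degree `d ≥ 1`
    nontriviality K
    intro y₁ y₂ h
    change AdjoinRoot.of f y₁ = AdjoinRoot.of f y₂ at h
    rw [← sub_eq_zero, ← map_sub, AdjoinRoot.of, RingHom.comp_apply, AdjoinRoot.mk_eq_zero] at h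
    have hdeg : (C (y₁ - y₂)).degree < f.degree := by
      change (C (y₁ - y₂)).degree < (X ^ d - C N : K[X]).degree
      rw [degree_X_pow_sub_C hd N]
      exact lt_of_le_of_lt degree_C_le (by exact_mod_cast hd)
    by_contra hne
    have hne' : C (y₁ - y₂) ≠ 0 := by
      rw [Ne, C_eq_zero, sub_eq_zero]; exact hne
    exact hf.not_dvd_of_degree_lt hne' hdeg h
  · change AdjoinRoot.lift _ _ hev (AdjoinRoot.of f y) = AdjoinRoot.of f (σ y)
    rw [AdjoinRoot.lift_of, RingHom.comp_apply]
  · exact AdjoinRoot.lift_root hev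
  · exact hroot

/-! ## The twisted radicand, assembled -/

/-- **THE CANONICAL TWISTED RADICAND (tri-2 CHAR2-TWIST §1).** Let `σ` be an endomorphism of a
commutative ring `K` with `σ^[p] = id` (`p ≥ 1`), `x ∈ K` a unit and `d ≥ 1` with `gcd(p, d) = 1`.
Then there are a commutative `K`-algebra `L` (`K → L` injective) with an endomorphism `τ`
extending `σ`, natural numbers `a ≥ 1`, `b` with `p·a = d·b + 1`, and elements `s, C ∈ L`, `C` a
unit with `C · x^p = N_σ(x) := ∏_{i<p} σ^i x`, such that **`s^d = x · C^a`** and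
**`τ(s) · σ(x)^b = s · x^b`** (so `τ s ∈ s · K^×`: the degree-`d` Kummer radicand `x·C^a` is
`σ`-stable). [folklore; tri-2 CHAR2-TWIST §1 «existence part of R-T for free»] -/
theorem exists_twistedRadicand {K : Type} [CommRing K] (σ : K →+* K) {p : ℕ} (hp : 0 < p)
    (hσ : ∀ y, (⇑σ)^[p] y = y) (x : K) (hx : IsUnit x) {d : ℕ} (hd : 0 < d)
    (hpd : Nat.Coprime p d) :
    ∃ (L : Type) (_ : CommRing L) (_ : Algebra K L) (τ : L →+* L) (a b : ℕ) (s C : L),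
      Function.Injective (algebraMap K L) ∧
      (∀ y, τ (algebraMap K L y) = algebraMap K L (σ y)) ∧
      0 < a ∧ p * a = d * b + 1 ∧ IsUnit C ∧
      C * algebraMap K L x ^ p = algebraMap K L (∏ i ∈ Finset.range p, (⇑σ)^[i] x) ∧
      s ^ d = algebraMap K L x * C ^ a ∧
      τ s * algebraMap K L (σ x) ^ b = s * algebraMap K L x ^ b := by
  obtain ⟨L, _, _, τ, ρ, hinj, hτ, hτρ, hρ⟩ := exists_kummer_extension σ hσ hd x
  obtain ⟨a, b, ha, hab⟩ := exists_bezout_of_coprime hp hd hpd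
  obtain ⟨u, hu⟩ := hx
  -- the inverse of `x` in `L`
  set xL : L := algebraMap K L x with hxL
  set yL : L := algebraMap K L (↑u⁻¹ : K) with hyL
  have hxy : xL * yL = 1 := by
    rw [hxL, hyL, ← map_mul, ← hu, Units.mul_inv, map_one]
  -- the norm element read in `L` is the norm element of `xL` for `τ`
  have hiter : ∀ i (y : K), (⇑τ)^[i] (algebraMap K L y) = algebraMap K L ((⇑σ)^[i] y) := by
    intro i
    induction i with
    | zero => intro y; rfl
    | succ i ih =>
      intro y
      rw [Function.iterate_succ_apply', Function.iterate_succ_apply', ih, hτ]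
  have hNL : algebraMap K L (∏ i ∈ Finset.range p, (⇑σ)^[i] x) =
      ∏ i ∈ Finset.range p, (⇑τ)^[i] xL := by
    rw [map_prod]
    exact Finset.prod_congr rfl fun i _ => (hiter i x).symm
  refine ⟨L, inferInstance, inferInstance, τ, a, b, ρ ^ a * yL ^ b,
    (∏ i ∈ Finset.range p, (⇑τ)^[i] xL) * yL ^ p, hinj, hτ, ha, hab,
    isUnit_normQuot τ p xL yL hxy, ?_, ?_, ?_⟩
  · -- `C · x^p = N`
    rw [hNL, mul_assoc, ← mul_pow, mul_comm yL xL, hxy, one_pow, mul_one]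
  · -- `s^d = x · C^a`
    exact twistedRadicand_pow hab xL yL ρ _ hxy (hρ.trans hNL)
  · -- `τ s · σ(x)^b = s · x^b`
    have h := map_twistedRadicand_mul τ a b xL yL ρ hxy hτρ
    rw [hxL, hτ] at h
    exact h

/-! ## (R5) The `J_m` data: any finite-order `k`-automorphism of `k[x₁,…,xₙ]`, any variable -/

/-- **(R5) The twisted radicand for polynomial data, uniformly in the Jordan size.** Let `σ` be a
`k`-algebra automorphism of `k[x₁,…,xₙ]` of finite order `p` (`σ^[p] = id`; e.g. one Jordan block
`J_m` with passengers, `m ≤ p`), `x_j` a variable (the vertex coordinate) and `d ≥ 1` with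
`gcd(p, d) = 1` (the vertex weight). Over the function field `K = k(x₁,…,xₙ)` (where `x_j` is a unit
and `σ` extends to `σ_K`), there are a `K`-algebra `L` (`K → L` injective) with an endomorphism `τ`
extending `σ_K`, `a ≥ 1`, `b` with `p·a = d·b + 1`, a unit `C` with `C · x_j^p = ∏_{i<p} σ^i x_j`, and
`s` with **`s^d = x_j · C^a`** and **`τ(s) · σ(x_j)^b = s · x_j^b`**.
[folklore; tri-2 CHAR2-TWIST §1, V4U-DESIGN §3 «H¹(ℤ/p, μ_d) = 0» made explicit] -/
theorem exists_twistedRadicand_mvPolynomial (k : Type) [Field k] (n : ℕ)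
    (σ : MvPolynomial (Fin n) k ≃ₐ[k] MvPolynomial (Fin n) k) {p : ℕ} (hp : 0 < p)
    (hσ : ∀ y, (⇑σ)^[p] y = y) (j : Fin n) {d : ℕ} (hd : 0 < d) (hpd : Nat.Coprime p d) :
    ∃ (L : Type) (_ : CommRing L) (_ : Algebra (FractionRing (MvPolynomial (Fin n) k)) L)
      (τ : L →+* L) (a b : ℕ) (s C : L),
      Function.Injective (algebraMap (FractionRing (MvPolynomial (Fin n) k)) L) ∧
      (∀ y : FractionRing (MvPolynomial (Fin n) k), τ (algebraMap (FractionRing (MvPolynomial (Fin n) k)) L y) =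
        algebraMap (FractionRing (MvPolynomial (Fin n) k)) L
          (IsFractionRing.ringEquivOfRingEquiv (K := FractionRing (MvPolynomial (Fin n) k))
            (L := FractionRing (MvPolynomial (Fin n) k))
            (σ : MvPolynomial (Fin n) k ≃+* MvPolynomial (Fin n) k) y)) ∧
      (∀ y : MvPolynomial (Fin n) k,
        τ (algebraMap (FractionRing (MvPolynomial (Fin n) k)) L (algebraMap (MvPolynomial (Fin n) k) (FractionRing (MvPolynomial (Fin n) k)) y)) =
          algebraMap (FractionRing (MvPolynomial (Fin n) k)) L (algebraMap (MvPolynomial (Fin n) k) (FractionRing (MvPolynomial (Fin n) k)) (σ y))) ∧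
      0 < a ∧ p * a = d * b + 1 ∧ IsUnit C ∧
      C * algebraMap (FractionRing (MvPolynomial (Fin n) k)) L
          (algebraMap (MvPolynomial (Fin n) k) (FractionRing (MvPolynomial (Fin n) k)) (MvPolynomial.X j)) ^ p =
        algebraMap (FractionRing (MvPolynomial (Fin n) k)) L (algebraMap (MvPolynomial (Fin n) k) (FractionRing (MvPolynomial (Fin n) k))
          (∏ i ∈ Finset.range p, (⇑σ)^[i] (MvPolynomial.X j))) ∧
      s ^ d = algebraMap (FractionRing (MvPolynomial (Fin n) k)) L
          (algebraMap (MvPolynomial (Fin n) k) (FractionRing (MvPolynomial (Fin n) k)) (MvPolynomial.X j)) * C ^ a ∧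
      τ s * algebraMap (FractionRing (MvPolynomial (Fin n) k)) L
          (algebraMap (MvPolynomial (Fin n) k) (FractionRing (MvPolynomial (Fin n) k)) (σ (MvPolynomial.X j))) ^ b =
        s * algebraMap (FractionRing (MvPolynomial (Fin n) k)) L
          (algebraMap (MvPolynomial (Fin n) k) (FractionRing (MvPolynomial (Fin n) k)) (MvPolynomial.X j)) ^ b := by
  let A := MvPolynomial (Fin n) k
  let K := FractionRing (MvPolynomial (Fin n) k)
  let σK : K ≃+* K := IsFractionRing.ringEquivOfRingEquiv (σ : A ≃+* A)
  have hσK : ∀ y : A, σK (algebraMap A K y) = algebraMap A K (σ y) := fun y =>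
    IsFractionRing.ringEquivOfRingEquiv_algebraMap (σ : A ≃+* A) y
  -- the extension has the same order
  have hiterA : ∀ i (y : A), (⇑σK)^[i] (algebraMap A K y) = algebraMap A K ((⇑σ)^[i] y) := by
    intro i
    induction i with
    | zero => intro y; rfl
    | succ i ih =>
      intro y
      rw [Function.iterate_succ_apply', Function.iterate_succ_apply', ih, hσK]
  have hσKp : ∀ y : K, (⇑(σK : K →+* K))^[p] y = y := by
    have hext : (σK : K →+* K) ^ p = RingHom.id K := by
      apply IsLocalization.ringHom_ext (nonZeroDivisors A)
      refine RingHom.ext fun y => ?_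
      rw [RingHom.comp_apply, RingHom.comp_apply, RingHom.id_apply, RingHom.coe_pow]
      change (⇑σK)^[p] (algebraMap A K y) = algebraMap A K y
      rw [hiterA, hσ]
    intro y
    rw [← RingHom.coe_pow, hext, RingHom.id_apply]
  have hx : IsUnit (algebraMap A K (MvPolynomial.X j)) :=
    isUnit_iff_ne_zero.mpr
      (IsFractionRing.to_map_ne_zero_of_mem_nonZeroDivisors
        (mem_nonZeroDivisors_of_ne_zero (MvPolynomial.X_ne_zero j)))
  obtain ⟨L, _, _, τ, a, b, s, C, hinj, hτ, ha, hab, hC, hCN, hs, hτs⟩ :=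
    exists_twistedRadicand (σK : K →+* K) hp hσKp (algebraMap A K (MvPolynomial.X j)) hx hd hpd
  refine ⟨L, inferInstance, inferInstance, τ, a, b, s, C, hinj, hτ, fun y => ?_, ha, hab, hC,
    ?_, hs, ?_⟩
  · rw [hτ]
    exact congrArg _ (hσK y)
  · rw [hCN, map_prod (algebraMap A K)]
    congr 1
    refine Finset.prod_congr rfl fun i _ => ?_
    change (⇑σK)^[i] (algebraMap A K (MvPolynomial.X j)) = _
    exact hiterA i _
  · have h := hτs
    change τ s * algebraMap K L (σK (algebraMap A K (MvPolynomial.X j))) ^ b = _ at h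
    rw [hσK] at h
    exact h

end Summit.ResolutionOfSingularities.ResolutionOfSingularities.Theorems.WildQuotientResolution.TwistedRoot

end
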